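import Summits.CriticalPhenomena.PercolationContinuityZ3.Theorems.PercNearOneGluingNoHeavyLowerTailSahiHittingSlot

/-!
# `NoHeavyLowerTail` (crux stmt-CriticalPhenomena-4575), Sahi / Kahn positivity: THE JUNTA-SLOT EXTENSION PRINCIPLE

Support file (cell `prim-l12`, seat P3, gen 3; `--supports stmt-CriticalPhenomena-4575`).  No `sorry`, no named facts, standard axioms.  New mathematics.

`…SahiHittingSlot` proves Kahn's Conjecture 5 for (hitting event, arbitrary, arbitrary) by a two-copy Harris certificate.  Nothing in the assembly
used that the first slot is a hitting event: this file records the general EXTENSION PRINCIPLE behind it.  Let `A ⊆ ι` be finite, `H` an increasing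
event determined by `A`, and `W ≥ 0` a weight on configurations.  Say `(H, W)` is a TWO-CONFIGURATION CERTIFICATE at `p` (`TwoConfigCert A p H W`) if for all
increasing `A`-determined `U₁, V₁, U₂, V₂`
  `E_ζ[W(ζ)(1_{U₁}−1_{U₂})(ζ)(1_{V₁}−1_{V₂})(ζ)] ≤ g_H(U₁,V₁;U₂,V₂) + g_H(U₂,V₂;U₁,V₁)`,
  `g_H(U₁,V₁;U₂,V₂) = 2μ(HU₁V₁) − μ(H)μ(U₁V₁) − μ(U₁)μ(HV₂) − μ(V₁)μ(HU₂) + μ(H)μ(U₁)μ(V₂)`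
— a statement on the finite cube `2^A` only (its diagonal `U₁ = U₂, V₁ = V₂` is `C₃` on `2^A` with first slot `H`).  THEN (`sahiE_three_nonneg_of_twoConfigCert`)
`E₃(1_H, 1_U, 1_V) ≥ 0` for ALL increasing events `U, V` of the whole cube `2^ι` — i.e. in every dimension.  Proof = the assembly of `…SahiHittingSlot`
verbatim: block-Fubini two-copy form `E₃ = Σ_{ω,ω'} w(ω)w(ω') g_H(loc_ω U, loc_ω V; loc_{ω'} U, loc_{ω'} V)` (`sahiE_three_eq_sum_kernel`), the certificate
pointwise in `(ω, ω')`, and Harris on the outside configuration for each fixed `A`-part.  The hitting theorem is the instance `H = hit A`, `W = Wt A p`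
(`twoConfigCert_hit`).
WHY IT MATTERS (census, this seat, kit j098912/j098913/j099083; memo prim-l12/FROM-prim-l12-p3-g3-HITTING-SLOT.md): for EVERY increasing `H` on `≤ 3`
coordinates and every tested `p` such a certificate exists (an LP over the `400²` pairs of local configurations; even DIAGONAL ones, `W` supported on `H`,
`Σ W = μ(H)`), so Kahn's conjecture for "one slot a `≤ 3`-junta, the other two arbitrary" reduces to writing those certificates in closed form.
HONEST FRAMING: this file proves the reduction; it asserts no certificate beyond the hitting one. [this work]
-/

noncomputable section

open scoped Classical

namespace Summit.CriticalPhenomena.PercolationContinuityZ3.Theorems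

namespace SahiHittingSlot

open Finset
open Literature.Combinatorics.Sahi2008
open Literature.Probability.Percolation (DeterminedBy determinedBy_iff)
open Literature.Probability.Percolation.BHK2006 (weight weight_nonneg harris ind_inter)
open Literature.Probability.Percolation.DecisionTree (ind ind_of_mem ind_of_not_mem ind_nonneg)

variable {ι : Type} [Fintype ι]

/-! ### The two-copy kernel for a general first slot -/

/-- The two-copy kernel with first slot `H`:
`g_H(U₁,V₁;U₂,V₂) = 2μ(H∩U₁∩V₁) − μ(H)μ(U₁∩V₁) − μ(U₁)μ(H∩V₂) − μ(V₁)μ(H∩U₂) + μ(H)μ(U₁)μ(V₂)`. [this work] -/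
def kernel (p : ι → unitInterval) (H U₁ V₁ U₂ V₂ : Set (Set ι)) : ℝ :=
  2 * pr p (H ∩ (U₁ ∩ V₁)) - pr p H * pr p (U₁ ∩ V₁) - pr p U₁ * pr p (H ∩ V₂) - pr p V₁ * pr p (H ∩ U₂)
    + pr p H * (pr p U₁ * pr p V₂)

omit [Fintype ι] in
/-- An `A`-determined event is its own localisation. [this work] -/
theorem loc_eq_self_of_determinedBy (A : Finset ι) (ω : Set ι) {H : Set (Set ι)} (hH : DeterminedBy H (↑A : Set ι)) :
    loc A ω H = H := by
  ext ζ
  rw [mem_loc]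
  exact mem_iff_of_inter_eq hH (Set.ite_inter_self _ _ _)

/-- The kernel through localisations. [this work] -/
theorem kernel_loc (p : ι → unitInterval) (A : Finset ι) {H : Set (Set ι)} (hH : DeterminedBy H (↑A : Set ι))
    (U V : Set (Set ι)) (ω ω' : Set ι) :
    kernel p H (loc A ω U) (loc A ω V) (loc A ω' U) (loc A ω' V) =
      2 * pr p (loc A ω (H ∩ (U ∩ V))) - pr p H * pr p (loc A ω (U ∩ V))
        - pr p (loc A ω U) * pr p (loc A ω' (H ∩ V)) - pr p (loc A ω V) * pr p (loc A ω' (H ∩ U))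
        + pr p H * (pr p (loc A ω U) * pr p (loc A ω' V)) := by
  simp only [kernel, loc_inter, loc_eq_self_of_determinedBy A _ hH]

/-- **Two-copy form of `E₃(1_H,1_U,1_V)` for an `A`-determined first slot**:
`E₃ = Σ_{ω,ω'} w(ω)w(ω') g_H(loc_ω U, loc_ω V; loc_{ω'} U, loc_{ω'} V)`. [this work] -/
theorem sahiE_three_eq_sum_kernel (p : ι → unitInterval) (A : Finset ι) {H : Set (Set ι)} (hH : DeterminedBy H (↑A : Set ι))
    (U V : Set (Set ι)) :
    sahiE (bernoulliWeight p) 3 ![ind H, ind U, ind V] =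
      ∑ ω, ∑ ω', bernoulliWeight p ω * bernoulliWeight p ω' *
        kernel p H (loc A ω U) (loc A ω V) (loc A ω' U) (loc A ω' V) := by
  have hprod : ∀ X Y : Set (Set ι), ind X * ind Y = ind (X ∩ Y) := fun X Y => funext fun ω => (ind_inter X Y ω).symm
  rw [sahiE_three]
  simp only [hprod]
  change 2 * pr p (H ∩ U ∩ V) + pr p H * pr p U * pr p V
      - (pr p H * pr p (U ∩ V) + pr p U * pr p (H ∩ V) + pr p V * pr p (H ∩ U)) = _
  have hone := sum_bernoulliWeight p
  simp only [kernel_loc p A hH]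
  have hsplit : ∀ ω ω', bernoulliWeight p ω * bernoulliWeight p ω' *
      (2 * pr p (loc A ω (H ∩ (U ∩ V))) - pr p H * pr p (loc A ω (U ∩ V))
        - pr p (loc A ω U) * pr p (loc A ω' (H ∩ V)) - pr p (loc A ω V) * pr p (loc A ω' (H ∩ U))
        + pr p H * (pr p (loc A ω U) * pr p (loc A ω' V)))
      = (2 * (bernoulliWeight p ω * pr p (loc A ω (H ∩ (U ∩ V))))
          - pr p H * (bernoulliWeight p ω * pr p (loc A ω (U ∩ V)))) * bernoulliWeight p ω'
        - (bernoulliWeight p ω * pr p (loc A ω U)) * (bernoulliWeight p ω' * pr p (loc A ω' (H ∩ V)))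
        - (bernoulliWeight p ω * pr p (loc A ω V)) * (bernoulliWeight p ω' * pr p (loc A ω' (H ∩ U)))
        + pr p H * ((bernoulliWeight p ω * pr p (loc A ω U)) * (bernoulliWeight p ω' * pr p (loc A ω' V))) :=
    fun ω ω' => by ring
  have hrow : ∀ ω, ∑ ω', bernoulliWeight p ω * bernoulliWeight p ω' *
      (2 * pr p (loc A ω (H ∩ (U ∩ V))) - pr p H * pr p (loc A ω (U ∩ V))
        - pr p (loc A ω U) * pr p (loc A ω' (H ∩ V)) - pr p (loc A ω V) * pr p (loc A ω' (H ∩ U))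
        + pr p H * (pr p (loc A ω U) * pr p (loc A ω' V)))
      = (2 * (bernoulliWeight p ω * pr p (loc A ω (H ∩ (U ∩ V))))
          - pr p H * (bernoulliWeight p ω * pr p (loc A ω (U ∩ V))))
        - (bernoulliWeight p ω * pr p (loc A ω U)) * pr p (H ∩ V)
        - (bernoulliWeight p ω * pr p (loc A ω V)) * pr p (H ∩ U)
        + pr p H * ((bernoulliWeight p ω * pr p (loc A ω U)) * pr p V) := by
    intro ω
    rw [sum_congr rfl fun ω' _ => hsplit ω ω', sum_add_distrib, sum_sub_distrib, sum_sub_distrib]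
    simp only [← mul_sum]
    rw [hone, mul_one, ← pr_eq_sum_loc, ← pr_eq_sum_loc, ← pr_eq_sum_loc]
  rw [sum_congr rfl fun ω _ => hrow ω, sum_add_distrib, sum_sub_distrib, sum_sub_distrib, sum_sub_distrib]
  simp only [← mul_sum, ← sum_mul]
  rw [← pr_eq_sum_loc, ← pr_eq_sum_loc, ← pr_eq_sum_loc, ← pr_eq_sum_loc, Set.inter_assoc]
  ring

/-! ### Two-configuration certificates and the extension principle -/

/-- `(H, W)` is a **two-configuration certificate** at `p` on the coordinates `A`: for all increasing `A`-determined `U₁, V₁, U₂, V₂`,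
`E_ζ[W(ζ)(1_{U₁}−1_{U₂})(1_{V₁}−1_{V₂})] ≤ g_H(U₁,V₁;U₂,V₂) + g_H(U₂,V₂;U₁,V₁)` — a statement about the finite cube `2^A` only. [this work] -/
def TwoConfigCert (A : Finset ι) (p : ι → unitInterval) (H : Set (Set ι)) (W : Set ι → ℝ) : Prop :=
  ∀ U₁ V₁ U₂ V₂ : Set (Set ι),
    DeterminedBy U₁ (↑A : Set ι) → DeterminedBy V₁ (↑A : Set ι) → DeterminedBy U₂ (↑A : Set ι) → DeterminedBy V₂ (↑A : Set ι) →
    IsUpperSet U₁ → IsUpperSet V₁ → IsUpperSet U₂ → IsUpperSet V₂ →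
      ∑ ζ, bernoulliWeight p ζ * (W ζ * ((ind U₁ ζ - ind U₂ ζ) * (ind V₁ ζ - ind V₂ ζ))) ≤
        kernel p H U₁ V₁ U₂ V₂ + kernel p H U₂ V₂ U₁ V₁

/-- **THE JUNTA-SLOT EXTENSION PRINCIPLE.**  If the increasing `A`-determined event `H` admits a two-configuration certificate with a nonnegative
weight `W` (a property of the cube `2^A`), then `E₃(1_H, 1_U, 1_V) ≥ 0` for ALL increasing events `U, V` of `2^ι` (every dimension). [this work] -/
theorem sahiE_three_nonneg_of_twoConfigCert (p : ι → unitInterval) (A : Finset ι) {H : Set (Set ι)} (hH : DeterminedBy H (↑A : Set ι))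
    {W : Set ι → ℝ} (hW : ∀ ζ, 0 ≤ W ζ) (hTC : TwoConfigCert A p H W) {U V : Set (Set ι)} (hU : IsUpperSet U) (hV : IsUpperSet V) :
    0 ≤ sahiE (bernoulliWeight p) 3 ![ind H, ind U, ind V] := by
  have hE := sahiE_three_eq_sum_kernel p A hH U V
  have hsymm : ∑ ω, ∑ ω', bernoulliWeight p ω * bernoulliWeight p ω' * kernel p H (loc A ω U) (loc A ω V) (loc A ω' U) (loc A ω' V)
      = ∑ ω, ∑ ω', bernoulliWeight p ω * bernoulliWeight p ω' * kernel p H (loc A ω' U) (loc A ω' V) (loc A ω U) (loc A ω V) := by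
    rw [sum_comm]; exact sum_congr rfl fun ω _ => sum_congr rfl fun ω' _ => by ring
  have h2E : 2 * sahiE (bernoulliWeight p) 3 ![ind H, ind U, ind V] =
      ∑ ω, ∑ ω', bernoulliWeight p ω * bernoulliWeight p ω' *
        (kernel p H (loc A ω U) (loc A ω V) (loc A ω' U) (loc A ω' V) + kernel p H (loc A ω' U) (loc A ω' V) (loc A ω U) (loc A ω V)) := by
    rw [two_mul, hE]
    nth_rw 2 [hsymm]
    rw [← sum_add_distrib]
    refine sum_congr rfl fun ω _ => ?_
    rw [← sum_add_distrib]
    exact sum_congr rfl fun ω' _ => by ring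
  have hK : ∀ ω ω', ∑ ζ, bernoulliWeight p ζ * (W ζ *
      ((ind U (Set.ite (↑A : Set ι) ζ ω) - ind U (Set.ite (↑A : Set ι) ζ ω')) *
        (ind V (Set.ite (↑A : Set ι) ζ ω) - ind V (Set.ite (↑A : Set ι) ζ ω')))) ≤
      kernel p H (loc A ω U) (loc A ω V) (loc A ω' U) (loc A ω' V) + kernel p H (loc A ω' U) (loc A ω' V) (loc A ω U) (loc A ω V) := by
    intro ω ω'
    have h := hTC _ _ _ _ (determinedBy_loc A ω U) (determinedBy_loc A ω V) (determinedBy_loc A ω' U) (determinedBy_loc A ω' V)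
      (isUpperSet_loc A ω hU) (isUpperSet_loc A ω hV) (isUpperSet_loc A ω' hU) (isUpperSet_loc A ω' hV)
    simp only [ind_loc] at h
    exact h
  have hsum : ∑ ω, ∑ ω', bernoulliWeight p ω * bernoulliWeight p ω' * ∑ ζ, bernoulliWeight p ζ * (W ζ *
      ((ind U (Set.ite (↑A : Set ι) ζ ω) - ind U (Set.ite (↑A : Set ι) ζ ω')) *
        (ind V (Set.ite (↑A : Set ι) ζ ω) - ind V (Set.ite (↑A : Set ι) ζ ω')))) ≤
      ∑ ω, ∑ ω', bernoulliWeight p ω * bernoulliWeight p ω' *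
        (kernel p H (loc A ω U) (loc A ω V) (loc A ω' U) (loc A ω' V) + kernel p H (loc A ω' U) (loc A ω' V) (loc A ω U) (loc A ω V)) :=
    sum_le_sum fun ω _ => sum_le_sum fun ω' _ =>
      mul_le_mul_of_nonneg_left (hK ω ω') (mul_nonneg (bw_nonneg p ω) (bw_nonneg p ω'))
  have hH0 : 0 ≤ ∑ ω, ∑ ω', bernoulliWeight p ω * bernoulliWeight p ω' * ∑ ζ, bernoulliWeight p ζ * (W ζ *
      ((ind U (Set.ite (↑A : Set ι) ζ ω) - ind U (Set.ite (↑A : Set ι) ζ ω')) *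
        (ind V (Set.ite (↑A : Set ι) ζ ω) - ind V (Set.ite (↑A : Set ι) ζ ω')))) := by
    have hre : ∑ ω, ∑ ω', bernoulliWeight p ω * bernoulliWeight p ω' * ∑ ζ, bernoulliWeight p ζ * (W ζ *
        ((ind U (Set.ite (↑A : Set ι) ζ ω) - ind U (Set.ite (↑A : Set ι) ζ ω')) *
          (ind V (Set.ite (↑A : Set ι) ζ ω) - ind V (Set.ite (↑A : Set ι) ζ ω')))) =
        ∑ ζ, bernoulliWeight p ζ * W ζ * ∑ ω, ∑ ω', bernoulliWeight p ω * bernoulliWeight p ω' *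
          ((ind U (Set.ite (↑A : Set ι) ζ ω) - ind U (Set.ite (↑A : Set ι) ζ ω')) *
            (ind V (Set.ite (↑A : Set ι) ζ ω) - ind V (Set.ite (↑A : Set ι) ζ ω'))) := by
      calc _ = ∑ ω, ∑ ω', ∑ ζ, bernoulliWeight p ω * bernoulliWeight p ω' * (bernoulliWeight p ζ * (W ζ *
              ((ind U (Set.ite (↑A : Set ι) ζ ω) - ind U (Set.ite (↑A : Set ι) ζ ω')) *
                (ind V (Set.ite (↑A : Set ι) ζ ω) - ind V (Set.ite (↑A : Set ι) ζ ω'))))) := by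
            simp only [mul_sum]
        _ = ∑ ω, ∑ ζ, ∑ ω', bernoulliWeight p ω * bernoulliWeight p ω' * (bernoulliWeight p ζ * (W ζ *
              ((ind U (Set.ite (↑A : Set ι) ζ ω) - ind U (Set.ite (↑A : Set ι) ζ ω')) *
                (ind V (Set.ite (↑A : Set ι) ζ ω) - ind V (Set.ite (↑A : Set ι) ζ ω'))))) :=
            sum_congr rfl fun ω _ => sum_comm
        _ = ∑ ζ, ∑ ω, ∑ ω', bernoulliWeight p ω * bernoulliWeight p ω' * (bernoulliWeight p ζ * (W ζ *
              ((ind U (Set.ite (↑A : Set ι) ζ ω) - ind U (Set.ite (↑A : Set ι) ζ ω')) *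
                (ind V (Set.ite (↑A : Set ι) ζ ω) - ind V (Set.ite (↑A : Set ι) ζ ω'))))) := sum_comm
        _ = _ := sum_congr rfl fun ζ _ => by
            rw [mul_sum]
            refine sum_congr rfl fun ω _ => ?_
            rw [mul_sum]
            exact sum_congr rfl fun ω' _ => by ring
    rw [hre]
    refine sum_nonneg fun ζ _ => mul_nonneg (mul_nonneg (bw_nonneg p ζ) (hW ζ)) ?_
    have hone := sum_bernoulliWeight p
    set uu : Set ι → ℝ := fun ω => ind U (Set.ite (↑A : Set ι) ζ ω) with huu
    set vv : Set ι → ℝ := fun ω => ind V (Set.ite (↑A : Set ι) ζ ω) with hvv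
    have hcov : ∑ ω, ∑ ω', bernoulliWeight p ω * bernoulliWeight p ω' * ((uu ω - uu ω') * (vv ω - vv ω')) =
        2 * (∑ ω, bernoulliWeight p ω * (uu ω * vv ω) -
          (∑ ω, bernoulliWeight p ω * uu ω) * (∑ ω, bernoulliWeight p ω * vv ω)) := by
      have hsp : ∀ ω ω', bernoulliWeight p ω * bernoulliWeight p ω' * ((uu ω - uu ω') * (vv ω - vv ω')) =
          (bernoulliWeight p ω * (uu ω * vv ω)) * bernoulliWeight p ω' - (bernoulliWeight p ω * uu ω) * (bernoulliWeight p ω' * vv ω')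
            - (bernoulliWeight p ω * vv ω) * (bernoulliWeight p ω' * uu ω') + bernoulliWeight p ω * (bernoulliWeight p ω' * (uu ω' * vv ω')) :=
        fun ω ω' => by ring
      have hrow : ∀ ω, ∑ ω', bernoulliWeight p ω * bernoulliWeight p ω' * ((uu ω - uu ω') * (vv ω - vv ω')) =
          (bernoulliWeight p ω * (uu ω * vv ω)) - (bernoulliWeight p ω * uu ω) * (∑ ω', bernoulliWeight p ω' * vv ω')
            - (bernoulliWeight p ω * vv ω) * (∑ ω', bernoulliWeight p ω' * uu ω')
            + bernoulliWeight p ω * (∑ ω', bernoulliWeight p ω' * (uu ω' * vv ω')) := by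
        intro ω
        rw [sum_congr rfl fun ω' _ => hsp ω ω', sum_add_distrib, sum_sub_distrib, sum_sub_distrib, ← mul_sum, ← mul_sum, ← mul_sum,
          ← mul_sum, hone, mul_one]
      rw [sum_congr rfl fun ω _ => hrow ω, sum_add_distrib, sum_sub_distrib, sum_sub_distrib, ← sum_mul, ← sum_mul, ← sum_mul, hone,
        one_mul]
      ring
    change 0 ≤ ∑ ω, ∑ ω', bernoulliWeight p ω * bernoulliWeight p ω' * ((uu ω - uu ω') * (vv ω - vv ω'))
    rw [hcov]
    have hh := harris (w := fun e => (p e : ℝ)) (p_nonneg p) (p_le_one p)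
      (f := uu) (g := vv) (fun ω => ind_nonneg _ _) (fun ω => ind_nonneg _ _)
      (monotone_ind_ite hU ζ) (monotone_ind_ite hV ζ)
    rw [show (∑ ω, weight (fun e => (p e : ℝ)) ω) = 1 from hone, one_mul] at hh
    change (∑ ω, bernoulliWeight p ω * uu ω) * (∑ ω, bernoulliWeight p ω * vv ω) ≤
      ∑ ω, bernoulliWeight p ω * (uu ω * vv ω) at hh
    linarith
  linarith [hH0.trans hsum, h2E]

/-- The hitting kernel is the general kernel at `H = hit A`. [this work] -/
theorem gfun_eq_kernel [LinearOrder ι] (A : Finset ι) (p : ι → unitInterval) (U₁ V₁ U₂ V₂ : Set (Set ι)) :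
    gfun A p U₁ V₁ U₂ V₂ = kernel p (hit A) U₁ V₁ U₂ V₂ := by
  simp only [gfun, kernel, pr_hit]

/-- **The hitting certificate** of `…SahiHittingSlot` in this language: `(hit A, Wt A p)` is a two-configuration certificate at every `p`.
[this work] -/
theorem twoConfigCert_hit [LinearOrder ι] (A : Finset ι) (p : ι → unitInterval) : TwoConfigCert A p (hit A) (Wt A p) := by
  intro U₁ V₁ U₂ V₂ hU₁d hV₁d hU₂d hV₂d hU₁ hV₁ hU₂ hV₂
  rw [← gfun_eq_kernel, ← gfun_eq_kernel]
  exact two_config A p hU₁d hV₁d hU₂d hV₂d hU₁ hV₁ hU₂ hV₂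

end SahiHittingSlot

end Summit.CriticalPhenomena.PercolationContinuityZ3.Theorems
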